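import Literature.MathematicalPhysics.QuantumFieldTheory.Balaban1983to89.Beta.DecimatedMoment

/-!
# Beta/StrangFixAlias — the exact position ↔ alias dictionary: (L0) ∧ (L1) of `Beta/DecimatedMoment` hold iff the
pattern's lattice Fourier symbol vanishes TOGETHER WITH ITS GRADIENT (value and first moments) at every non-zero alias

HONEST FRAMING (cell `pub-balaban`; B12 paper sub-cell, row b2b-balaban-b12-g10, journal claim
BETA-b12-STRANGFIX-ALIAS).  The β sub-cell tries to discharge the one-loop input of [Balaban1987RG1] Theorem 2; that
would make Bałaban's ultraviolet STABILITY theorem unconditional — NOT the continuum limit, NOT the Clay problem — and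
this file is far less: finite Fourier analysis on the group `(ℤ/N)^d` applied to finitely supported lattice patterns.
Value = kernel certificate of a dictionary step, NOT summit progress.  (Gloss 1, BETA-SPEC l. 17–18, GAPS G-ref2-14
(a) / G-ref2-20 (a) / G-ref2-27 (b), verbatim: «UNCONDITIONAL» in [Balaban1989LargeFieldII] (B16) p. 355's
interval-hypothesis sense ONLY — relative to the hypothesis `g_k ∈ ]0, γ]` along the run, which
`FlowStepRuns.p355Unconditional_of_partialSums` keeps as `hnodes`; the located leaves G-adv3-2, G-adv3-1 and
`SecondExpLeaf` REMAIN.  Gloss 2, BETA-SPEC v1.9e, beta-ref C-beta-78, BINDING: «unconditional» =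
`Beta.Assembly.EventualForm`-unconditional END statement — the interval hypothesis removed, (0.31) in DEFECTED form on
all lattices (`PrefixAbsorption.thm2Defected_of_eventualForm`), admissible couplings shrunk — NOT «[Balaban1987RG1]
Theorem 2 as printed» (`PrefixAbsorption.eventualForm_not_thm2Printed`, RULING (R6)); never the continuum limit / mass
gap / Clay.  A Gloss 3′ for the composed road is PROPOSED in BETA-SPEC v1.9p §7.18 and not binding.)  THIS MODULE
DISCHARGES NOTHING of the series.

CONTEXT (internal records, not literature and not used as facts). RULING (R11) ADDENDUM (BETA-SPEC v1.9q §7.19;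
journal 2026-08-19T00:51:07Z) renames the residual of the certificate [H-germ′] as (H-aff)_k ∧ (Q-aff) ∧ (I4′) ∧ (O1),
with (H-aff)_k = «the linearised gauge-fixed k-fold minimiser at U = 1 (B11's 𝓗) reproduces affine connections modulo
gauge» (journal 2026-08-19T00:46:56Z, an2-g4) — i.e. hypotheses (L0)/(L1) of `Beta/DecimatedMoment` for its response
pattern — and STEERS: «take (H-aff)_k in ALIAS/Fourier form at U = 1 — (L0)/(L1) ⟺ ĥ vanishes to 2nd order at non-zero
aliases». This file certifies exactly that «⟺», for finitely supported patterns, with both normalisations made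
explicit, so that a symbol computation (owners: the an5 / an2 lineages) can be fed into
`DecimatedMoment.windowed_second_moment_dressed` / `windowed_second_moment_iter` /
`StrangFixMoment.strangFix_second_moment` without a gap.  It makes no statement about Bałaban's minimiser;
`Ã = liftZ N A` below is any integer lift of a residue vector `A`.

WHAT IS IN PRINT (context only).  [Buhmann2003] §4.2, PDF p. 72: «These conditions (4.16)–(4.18) are also known
as the Strang and Fix conditions»; in the form of arXiv:2406.16088, p. 2, «Theorem 1 (Strang and Fix conditions)»,
third hypothesis: «D^α Ψ̂(2πj) = 0, ∀ j ∈ ℤ^n∖{0} and ∀ α ∈ ℤ_+^n with |α| ≤ m» — the symbol vanishes together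
with its derivatives up to the reproduction degree at every non-zero point of `2πℤ^n`: the Fourier-side form of
polynomial reproduction by lattice translates.  Here the «function» is a finitely supported lattice pattern `w` on
`ℤ^d`, the translates are by the COARSE lattice `N•ℤ^d`, the degree is `m = 1` (affine reproduction: value and first
derivatives), the non-zero points of `2πℤ^n` become the `N^d − 1` non-zero ALIASES `p = 2πl/N`,
`l ∈ (ℤ/N)^d ∖ {0}`, and `ŵ(p)`, `∂_κ ŵ(p)` are the finite character sums `aliasMoment` below; the statement is then
EXACT finite Fourier analysis on `(ℤ/N)^d`, which is what is proved (both directions, normalisations explicit).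
[Balaban1987RG1] p. 264 (1.22) «β_{j+1}(g_j) = … = Σ_x Π_{j+1,μν}(g_j, x)x_μx_ν for μ, ν arbitrary, μ ≠ ν» is
where second moments of dressed, decimated kernels enter (`Beta/MomentFactorisation`, `Beta/DecimatedMoment`,
`Beta/StrangFixMoment`); nothing of it is used here.

WHAT THIS FILE PROVES (all [folklore]; `R` any ring carrying a `ℂ`-module structure — `ℂ`, `Matrix n n ℂ`,
noncommutative allowed —, any `d`, any `N ≥ 1` (`[NeZero N]`); `w : LatFun d R` finitely supported; `ū = redN N u` the
coordinatewise residue; `e_N(l, a) = achar l a = ∏_μ exp(2πi l_μ a_μ / N)` the characters of `(ℤ/N)^d`;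
`cosetMoment N φ w a = Σ_{u ≡ a (N)} φ(u) • w(u)`; `aliasMoment N φ l w = Σ_u (e_N(l, ū) φ(u)) • w(u)`):
* §1 characters: `sum_achar_right` / `sum_achar_left` — ORTHOGONALITY `Σ_a e_N(l, a) = [l = 0]·N^d` (engine: Mathlib's
  `AddChar.sum_mulShift` for the primitive character `ZMod.stdAddChar`, and `Finset.prod_univ_sum`);
  `achar_redN_eq_exp` — `e_N(l̄, ū) = exp(2πi (l·u)/N)`: the character IS the plane wave of the alias momentum
  `p = 2πl/N` sampled on `ℤ^d`, so `aliasMoment N (fun _ => 1) l̄ w = Σ_u e^{ip·u} • w(u) = ŵ(p)` and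
  `aliasMoment N (fun u => u κ) l̄ w = Σ_u u_κ e^{ip·u} • w(u) = −i ∂_κ ŵ(p)` (`aliasMoment_redN_eq`);
* §2 `inversion_of_charSums_eq_zero` / `charSums_eq_zero_iff_const` — for `f : (ℤ/N)^d → M` (`M` a `ℂ`-module):
  all NON-TRIVIAL character sums `Σ_a e_N(l, a) • f a`, `l ≠ 0`, vanish ⟺ `f` is constant (then `N^d • f b = Σ_a f a`);
* §3 the dictionary: `cosetInd_sub_eq_ite` (`DecimatedMoment.cosetInd N (a − u) = [ū = ā]`),
  `sum_achar_smul_cosetMoment` (REGROUPING BY COSETS: `Σ_A e_N(l, A) • cosetMoment N φ w Ã = aliasMoment N φ l w`),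
  `sum_cosetMoment` (`Σ_A cosetMoment N φ w Ã = moment φ w`), and the MASTER EQUIVALENCE `cosetMoment_const_iff`:
  `(∀ a, cosetMoment N φ w a = c) ⟺ (moment φ w = N^d • c ∧ ∀ l ≠ 0, aliasMoment N φ l w = 0)`;
* §4 the instances: `constRepro_iff_alias` — (L0) `ConstRepro N w σ ⟺ (M0 w = N^d • σ ∧ ∀ l ≠ 0, ŵ-alias sums = 0)`;
  `linRepro_iff_alias` — (L1) `LinRepro N w C ⟺ ∀ κ, (M1 κ w = N^d • C κ ∧ ∀ l ≠ 0, first alias moments = 0)`;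
  `affineRepro_iff_alias` — (L0) ∧ (L1) ⟺ the two normalisations ∧ VANISHING OF THE SYMBOL AND OF ALL ITS FIRST
  MOMENTS (its gradient) at every non-zero alias — «vanishing to second order» in the parlance of BETA-SPEC §7.19;
  `exists_constRepro_iff_alias` / `exists_linRepro_iff_alias` — the normalisation-free forms (constants / affine data
  reproduced for SOME `σ`, `C` ⟺ pure alias vanishing).

WHAT THIS FILE DOES NOT DO.  Infinite support / decaying patterns (the (O1) passage `T ↗ ℤ^d`); anything about the
actual minimiser `𝓗` of [Balaban1985Variational] / the response of Bałaban's background map ((H-aff)_k itself); the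
covariant / vector-valued dictionary row of BETA-SPEC §7.19 (an5 / an2).  Labels: [folklore] = standard finite Fourier
analysis, proved here in full; no cited facts are used.

Version v1 (2026-08-19, b2b-balaban-b12-g10).  value = kernel dictionary leaf, NOT summit progress.
-/

namespace Literature.MathematicalPhysics.QuantumFieldTheory.Balaban1983to89.Beta.StrangFixAlias

open Finset

/-! ## §1 The characters of `(ℤ/N)^d`, orthogonality, and the plane-wave dictionary -/

section Characters

variable {d : ℕ} {N : ℕ}

/-- Coordinatewise reduction `ℤ^d → (ℤ/N)^d`, `u ↦ ū`. [folklore] -/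
def redN (N : ℕ) (u : Fin d → ℤ) : Fin d → ZMod N := fun μ => ((u μ : ℤ) : ZMod N)

/-- `ū = 0 ⟺ u ∈ N•ℤ^d`: the trivial character corresponds to the coarse lattice itself, the non-zero `l` to the
genuine aliases. [folklore] -/
theorem redN_eq_zero_iff (u : Fin d → ℤ) : redN N u = 0 ↔ ∀ μ, (N : ℤ) ∣ u μ := by
  rw [funext_iff]
  refine forall_congr' (fun μ => ?_)
  rw [Pi.zero_apply, redN, ZMod.intCast_zmod_eq_zero_iff_dvd]

variable [NeZero N]

/-- The ALIAS CHARACTER `e_N(l, a) = ∏_μ exp(2πi · l_μ a_μ / N)` of the finite group `(ℤ/N)^d`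
(Mathlib's `ZMod.stdAddChar` coordinatewise). [folklore] -/
noncomputable def achar (l a : Fin d → ZMod N) : ℂ := ∏ μ, (ZMod.stdAddChar (l μ * a μ) : ℂ)

/-- The pairing is symmetric. [folklore] -/
theorem achar_comm (l a : Fin d → ZMod N) : achar l a = achar a l := by
  unfold achar
  exact Finset.prod_congr rfl (fun μ _ => by rw [mul_comm])

/-- The trivial character is `1`. [folklore] -/
theorem achar_zero_left (a : Fin d → ZMod N) : achar 0 a = 1 := by
  unfold achar
  simp only [Pi.zero_apply, zero_mul, AddChar.map_zero_eq_one, Finset.prod_const_one]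

/-- Every character is `1` at the origin. [folklore] -/
theorem achar_zero_right (l : Fin d → ZMod N) : achar l 0 = 1 := by
  rw [achar_comm]; exact achar_zero_left l

/-- Multiplicativity in the second slot. [folklore] -/
theorem achar_add_right (l a b : Fin d → ZMod N) : achar l (a + b) = achar l a * achar l b := by
  unfold achar
  rw [← Finset.prod_mul_distrib]
  exact Finset.prod_congr rfl (fun μ _ => by rw [Pi.add_apply, mul_add, AddChar.map_add_eq_mul])

/-- Multiplicativity, subtraction form. [folklore] -/
theorem achar_sub_right (l a b : Fin d → ZMod N) : achar l (a - b) = achar l a * achar l (-b) := by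
  rw [sub_eq_add_neg, achar_add_right]

/-- `e_N(l, −b) e_N(l, b) = 1`. [folklore] -/
theorem achar_neg_mul_self (l b : Fin d → ZMod N) : achar l (-b) * achar l b = 1 := by
  rw [← achar_add_right, neg_add_cancel, achar_zero_right]

/-- One-dimensional orthogonality (Mathlib `AddChar.sum_mulShift` for the primitive character `ZMod.stdAddChar`):
`Σ_{x ∈ ℤ/N} exp(2πi·kx/N) = [k = 0]·N`. [folklore] -/
theorem sum_stdAddChar_mul (k : ZMod N) :
    ∑ x : ZMod N, (ZMod.stdAddChar (k * x) : ℂ) = if k = 0 then (N : ℂ) else 0 := by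
  have h1 : ∑ x : ZMod N, (ZMod.stdAddChar (k * x) : ℂ) = ∑ x : ZMod N, (ZMod.stdAddChar (x * k) : ℂ) :=
    Finset.sum_congr rfl (fun x _ => by rw [mul_comm])
  rw [h1, AddChar.sum_mulShift k (ZMod.isPrimitive_stdAddChar N)]
  by_cases hk : k = 0
  · simp [hk, ZMod.card]
  · simp [hk]

/-- ORTHOGONALITY on `(ℤ/N)^d` (second slot summed): `Σ_a e_N(l, a) = [l = 0]·N^d`. [folklore] -/
theorem sum_achar_right (l : Fin d → ZMod N) :
    ∑ a : Fin d → ZMod N, achar l a = if l = 0 then (N : ℂ) ^ d else 0 := by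
  have key : ∑ a : Fin d → ZMod N, achar l a
      = ∏ μ : Fin d, ∑ x : ZMod N, (ZMod.stdAddChar (l μ * x) : ℂ) := by
    unfold achar
    rw [Finset.prod_univ_sum, Fintype.piFinset_univ]
  rw [key, Finset.prod_congr rfl (fun μ _ => sum_stdAddChar_mul (l μ))]
  by_cases hl : l = 0
  · subst hl
    simp
  · rw [if_neg hl]
    obtain ⟨μ, hμ⟩ := Function.ne_iff.mp hl
    exact Finset.prod_eq_zero (Finset.mem_univ μ) (if_neg hμ)

/-- ORTHOGONALITY on `(ℤ/N)^d` (first slot summed): `Σ_l e_N(l, a) = [a = 0]·N^d`. [folklore] -/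
theorem sum_achar_left (a : Fin d → ZMod N) :
    ∑ l : Fin d → ZMod N, achar l a = if a = 0 then (N : ℂ) ^ d else 0 := by
  rw [← sum_achar_right a]
  exact Finset.sum_congr rfl (fun l _ => achar_comm l a)

/-- PLANE-WAVE DICTIONARY: for integer vectors `l, u`, `e_N(l̄, ū) = exp(2πi (l·u)/N)` — the alias character is the
plane wave of momentum `p = 2πl/N` sampled at the lattice point `u`. [folklore] -/
theorem achar_redN_eq_exp (l u : Fin d → ℤ) :
    achar (redN N l) (redN N u)
      = Complex.exp (2 * Real.pi * Complex.I * ((∑ μ, l μ * u μ : ℤ) : ℂ) / N) := by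
  unfold achar redN
  have h : ∀ μ : Fin d, (ZMod.stdAddChar (((l μ : ℤ) : ZMod N) * ((u μ : ℤ) : ZMod N)) : ℂ)
      = Complex.exp (2 * Real.pi * Complex.I * ((l μ * u μ : ℤ) : ℂ) / N) := by
    intro μ
    rw [← Int.cast_mul, ZMod.stdAddChar_coe]
  rw [Finset.prod_congr rfl (fun μ _ => h μ), ← Complex.exp_sum]
  congr 1
  push_cast
  rw [Finset.mul_sum, Finset.sum_div]

end Characters

/-! ## §2 The Fourier criterion for constancy on `(ℤ/N)^d` -/

section Fourier

variable {d : ℕ} {N : ℕ} [NeZero N]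
variable {M : Type*} [AddCommGroup M] [Module ℂ M]

/-- A constant has vanishing non-trivial character sums. [folklore] -/
theorem charSum_smul_const {l : Fin d → ZMod N} (hl : l ≠ 0) (m : M) :
    ∑ a : Fin d → ZMod N, achar l a • m = 0 := by
  rw [← Finset.sum_smul, sum_achar_right, if_neg hl, zero_smul]

/-- FOURIER INVERSION AT FREQUENCY ZERO: if all non-trivial character sums of `f` vanish, then
`N^d • f b = Σ_a f a` for every `b`. (Both sides equal `Σ_l Σ_a e_N(l, a − b) • f a`.) [folklore] -/
theorem inversion_of_charSums_eq_zero (f : (Fin d → ZMod N) → M)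
    (h : ∀ l : Fin d → ZMod N, l ≠ 0 → ∑ a, achar l a • f a = 0) (b : Fin d → ZMod N) :
    ((N : ℂ) ^ d) • f b = ∑ a, f a := by
  have hD₁ : ∑ l : Fin d → ZMod N, ∑ a, achar l (a - b) • f a = ((N : ℂ) ^ d) • f b := by
    rw [Finset.sum_comm]
    have inner : ∀ a : Fin d → ZMod N,
        ∑ l : Fin d → ZMod N, achar l (a - b) • f a = if a = b then ((N : ℂ) ^ d) • f a else 0 := by
      intro a
      rw [← Finset.sum_smul, sum_achar_left]
      by_cases hab : a = b
      · rw [if_pos (sub_eq_zero.mpr hab), if_pos hab]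
      · rw [if_neg (fun h' => hab (sub_eq_zero.mp h')), if_neg hab, zero_smul]
    rw [Finset.sum_congr rfl (fun a _ => inner a)]
    simp only [Finset.sum_ite_eq', Finset.mem_univ, if_true]
  have hD₂ : ∑ l : Fin d → ZMod N, ∑ a, achar l (a - b) • f a = ∑ a, f a := by
    have inner : ∀ l : Fin d → ZMod N,
        ∑ a, achar l (a - b) • f a = achar l (-b) • ∑ a, achar l a • f a := by
      intro l
      rw [Finset.smul_sum]
      exact Finset.sum_congr rfl (fun a _ => by rw [smul_smul, achar_sub_right, mul_comm])
    rw [Finset.sum_congr rfl (fun l _ => inner l), Finset.sum_eq_single (0 : Fin d → ZMod N)]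
    · rw [achar_zero_left, one_smul]
      exact Finset.sum_congr rfl (fun a _ => by rw [achar_zero_left, one_smul])
    · intro l _ hl
      rw [h l hl, smul_zero]
    · intro h0
      exact absurd (Finset.mem_univ _) h0
  rw [← hD₁, hD₂]

/-- FOURIER CRITERION FOR CONSTANCY: all non-trivial character sums of `f : (ℤ/N)^d → M` vanish iff `f` is constant.
[folklore] -/
theorem charSums_eq_zero_iff_const (f : (Fin d → ZMod N) → M) :
    (∀ l : Fin d → ZMod N, l ≠ 0 → ∑ a, achar l a • f a = 0) ↔ ∀ a b, f a = f b := by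
  constructor
  · intro h a b
    have ha := inversion_of_charSums_eq_zero f h a
    have hb := inversion_of_charSums_eq_zero f h b
    have hNe : ((N : ℂ) ^ d) ≠ 0 := pow_ne_zero _ (Nat.cast_ne_zero.mpr (NeZero.ne N))
    calc f a = ((N : ℂ) ^ d)⁻¹ • (((N : ℂ) ^ d) • f a) := (inv_smul_smul₀ hNe _).symm
      _ = ((N : ℂ) ^ d)⁻¹ • (((N : ℂ) ^ d) • f b) := by rw [ha, hb]
      _ = f b := inv_smul_smul₀ hNe _
  · intro h l hl
    calc ∑ a, achar l a • f a = ∑ a, achar l a • f 0 :=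
          Finset.sum_congr rfl (fun a _ => by rw [h a 0])
      _ = 0 := charSum_smul_const hl (f 0)

end Fourier

/-! ## §3 Lattice patterns: coset moments, alias moments, the master equivalence -/

section Lattice

open MomentFactorisation DecimatedMoment

variable {d : ℕ} {R : Type*} [Ring R]
variable (N : ℕ)

/-- Coordinatewise divisibility of `a − u` by `N` ⟺ equal residues. [folklore] -/
theorem forall_dvd_sub_iff (a u : Fin d → ℤ) :
    (∀ i, (N : ℤ) ∣ (a - u) i) ↔ redN N u = redN N a := by
  rw [funext_iff]
  refine forall_congr' (fun i => ?_)
  rw [Pi.sub_apply]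
  show _ ↔ ((u i : ℤ) : ZMod N) = ((a i : ℤ) : ZMod N)
  rw [ZMod.intCast_eq_intCast_iff_dvd_sub]

/-- THE WINDOW IS A RESIDUE INDICATOR: `DecimatedMoment.cosetInd N (a − u) = [ū = ā]`. [folklore] -/
theorem cosetInd_sub_eq_ite (a u : Fin d → ℤ) :
    cosetInd N (a - u) = if redN N u = redN N a then 1 else 0 := by
  unfold cosetInd
  by_cases h : redN N u = redN N a
  · rw [if_pos h, if_pos ((forall_dvd_sub_iff N a u).mpr h)]
  · rw [if_neg h, if_neg (fun h' => h ((forall_dvd_sub_iff N a u).mp h'))]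

/-- COSET MOMENT with integer weight `φ`: `cosetMoment N φ w a = Σ_{u ≡ a (N)} φ(u) • w(u)`
(`φ = 1`: the coset sums of (L0) `ConstRepro`; `φ = (·) κ`: the coset first moments of (L1) `LinRepro`). [folklore] -/
noncomputable def cosetMoment (φ : (Fin d → ℤ) → ℤ) (w : LatFun d R) (a : Fin d → ℤ) : R :=
  moment (fun u => cosetInd N (a - u) * φ u) w

/-- The coset moment depends on `a` only through `ā`. [folklore] -/
theorem cosetMoment_congr {a a' : Fin d → ℤ} (h : redN N a = redN N a') (φ : (Fin d → ℤ) → ℤ)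
    (w : LatFun d R) : cosetMoment N φ w a = cosetMoment N φ w a' := by
  unfold cosetMoment moment
  exact Finsupp.sum_congr (fun u _ => by simp only [cosetInd_sub_eq_ite, h])

/-- Integer lift of a residue vector (`ZMod.val` coordinatewise). [folklore] -/
def liftZ (A : Fin d → ZMod N) : Fin d → ℤ := fun μ => ((A μ).val : ℤ)

variable [Module ℂ R] [NeZero N]

/-- `redN ∘ liftZ = id`. [folklore] -/
theorem redN_liftZ (A : Fin d → ZMod N) : redN N (liftZ N A) = A := by
  funext μ
  simp [redN, liftZ]

/-- ALIAS MOMENT with integer weight `φ` at the alias `l ∈ (ℤ/N)^d`: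
`aliasMoment N φ l w = Σ_u (e_N(l, ū) · φ(u)) • w(u)` — for `φ = 1` the value `ŵ(2πl/N)` of the pattern's symbol at
the alias momentum, for `φ = (·) κ` its `κ`-th first moment there (`= −i ∂_κ ŵ` at the alias, cf. `achar_redN_eq_exp`).
[folklore] -/
noncomputable def aliasMoment (φ : (Fin d → ℤ) → ℤ) (l : Fin d → ZMod N) (w : LatFun d R) : R :=
  w.sum fun u r => (achar l (redN N u) * (φ u : ℂ)) • r

/-- The coset moment at an integer lift, as an indicator sum over the support. [folklore] -/
theorem cosetMoment_liftZ (φ : (Fin d → ℤ) → ℤ) (w : LatFun d R) (A : Fin d → ZMod N) :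
    cosetMoment N φ w (liftZ N A)
      = ∑ u ∈ w.support, (if redN N u = A then ((φ u : ℤ) : ℂ) • w u else 0) := by
  unfold cosetMoment moment Finsupp.sum
  refine Finset.sum_congr rfl (fun u _ => ?_)
  dsimp only
  rw [cosetInd_sub_eq_ite, redN_liftZ]
  by_cases h : redN N u = A
  · rw [if_pos h, if_pos h, one_mul, Int.cast_smul_eq_zsmul]
  · rw [if_neg h, if_neg h, zero_mul, zero_smul]

/-- REGROUPING BY COSETS: the character sum of the coset moments is the alias moment,
`Σ_A e_N(l, A) • cosetMoment N φ w Ã = aliasMoment N φ l w`. [folklore] -/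
theorem sum_achar_smul_cosetMoment (φ : (Fin d → ℤ) → ℤ) (l : Fin d → ZMod N) (w : LatFun d R) :
    ∑ A : Fin d → ZMod N, achar l A • cosetMoment N φ w (liftZ N A) = aliasMoment N φ l w := by
  simp_rw [cosetMoment_liftZ, Finset.smul_sum, smul_ite, smul_zero]
  rw [Finset.sum_comm]
  unfold aliasMoment Finsupp.sum
  refine Finset.sum_congr rfl (fun u _ => ?_)
  simp only [Finset.sum_ite_eq, Finset.mem_univ, if_true]
  rw [smul_smul]

/-- TOTAL: the coset moments sum, over all `N^d` cosets, to the full moment `moment φ w`. [folklore] -/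
theorem sum_cosetMoment (φ : (Fin d → ℤ) → ℤ) (w : LatFun d R) :
    ∑ A : Fin d → ZMod N, cosetMoment N φ w (liftZ N A) = moment φ w := by
  have h := sum_achar_smul_cosetMoment N φ 0 w
  simp only [achar_zero_left, one_smul] at h
  rw [h]
  unfold aliasMoment moment
  exact Finsupp.sum_congr (fun u _ => by rw [achar_zero_left, one_mul, Int.cast_smul_eq_zsmul])

/-- `#(ℤ/N)^d = N^d`. [folklore] -/
theorem card_residues : Fintype.card (Fin d → ZMod N) = N ^ d := by
  rw [Fintype.card_fun, ZMod.card, Fintype.card_fin]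

/-- **MASTER EQUIVALENCE** (exact; finite support; any `N ≥ 1`, any `d`, any `ℂ`-module ring `R`): the coset
`φ`-moments of `w` are ALL equal to `c` iff the full `φ`-moment is `N^d • c` AND the alias `φ`-moment vanishes at every
NON-ZERO alias. [folklore] -/
theorem cosetMoment_const_iff (φ : (Fin d → ℤ) → ℤ) (w : LatFun d R) (c : R) :
    (∀ a : Fin d → ℤ, cosetMoment N φ w a = c) ↔
      (moment φ w = ((N : ℂ) ^ d) • c ∧
        ∀ l : Fin d → ZMod N, l ≠ 0 → aliasMoment N φ l w = 0) := by
  constructor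
  · intro h
    have hA : ∀ A : Fin d → ZMod N, cosetMoment N φ w (liftZ N A) = c := fun A => h _
    refine ⟨?_, fun l hl => ?_⟩
    · rw [← sum_cosetMoment N φ w, Finset.sum_congr rfl (fun A _ => hA A), Finset.sum_const, Finset.card_univ,
        card_residues, ← Nat.cast_smul_eq_nsmul ℂ, Nat.cast_pow]
    · rw [← sum_achar_smul_cosetMoment N φ l w, Finset.sum_congr rfl (fun A _ => by rw [hA A])]
      exact charSum_smul_const hl c
  · rintro ⟨hm, hal⟩ a
    have hinv := inversion_of_charSums_eq_zero (fun A => cosetMoment N φ w (liftZ N A))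
      (fun l hl => by rw [sum_achar_smul_cosetMoment]; exact hal l hl) (redN N a)
    rw [sum_cosetMoment, hm] at hinv
    have hNe : ((N : ℂ) ^ d) ≠ 0 := pow_ne_zero _ (Nat.cast_ne_zero.mpr (NeZero.ne N))
    calc cosetMoment N φ w a = cosetMoment N φ w (liftZ N (redN N a)) :=
          cosetMoment_congr N (by rw [redN_liftZ]) φ w
      _ = ((N : ℂ) ^ d)⁻¹ • (((N : ℂ) ^ d) • cosetMoment N φ w (liftZ N (redN N a))) :=
          (inv_smul_smul₀ hNe _).symm
      _ = ((N : ℂ) ^ d)⁻¹ • (((N : ℂ) ^ d) • c) := by rw [hinv]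
      _ = c := inv_smul_smul₀ hNe _

/-- The alias moments at an integer representative `l ∈ ℤ^d` are trigonometric sums at the alias momentum `p = 2πl/N`:
`aliasMoment N φ l̄ w = Σ_u (e^{ip·u} φ(u)) • w(u)`. [folklore] -/
theorem aliasMoment_redN_eq (φ : (Fin d → ℤ) → ℤ) (l : Fin d → ℤ) (w : LatFun d R) :
    aliasMoment N φ (redN N l) w
      = w.sum fun u r =>
          (Complex.exp (2 * Real.pi * Complex.I * ((∑ μ, l μ * u μ : ℤ) : ℂ) / N) * (φ u : ℂ)) • r := by
  unfold aliasMoment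
  exact Finsupp.sum_congr (fun u _ => by rw [achar_redN_eq_exp])

/-- Every alias `l ∈ (ℤ/N)^d` has an integer representative. [folklore] -/
theorem exists_redN_eq (l : Fin d → ZMod N) : ∃ l' : Fin d → ℤ, redN N l' = l := ⟨liftZ N l, redN_liftZ N l⟩

/-! ## §4 The instances: (L0), (L1), (L0) ∧ (L1) of `Beta/DecimatedMoment` in alias form -/

/-- **(L0) IN ALIAS FORM**: `ConstRepro N w σ` (every coset sum of `w` is `σ`) ⟺ `M0 w = N^d • σ` and the symbol of
`w` VANISHES at every non-zero alias: `∀ l ≠ 0, Σ_u e_N(l, ū) • w(u) = 0`. [folklore] -/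
theorem constRepro_iff_alias (w : LatFun d R) (σ : R) :
    ConstRepro N w σ ↔
      (M0 w = ((N : ℂ) ^ d) • σ ∧
        ∀ l : Fin d → ZMod N, l ≠ 0 → aliasMoment N (fun _ => 1) l w = 0) := by
  have h := cosetMoment_const_iff N (fun _ => (1 : ℤ)) w σ
  have e : ∀ a, cosetMoment N (fun _ => (1 : ℤ)) w a = moment (fun u => cosetInd N (a - u)) w := by
    intro a
    unfold cosetMoment
    simp only [mul_one]
  simp only [e] at h
  exact h

/-- **(L1) IN ALIAS FORM**: `LinRepro N w C` (every coset first moment `Σ_{u ≡ a} u_κ • w(u)` is `C κ`) ⟺ for every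
`κ`, `M1 κ w = N^d • C κ` and the `κ`-th FIRST MOMENT of the symbol vanishes at every non-zero alias:
`∀ l ≠ 0, Σ_u (e_N(l, ū) u_κ) • w(u) = 0`. [folklore] -/
theorem linRepro_iff_alias (w : LatFun d R) (C : Fin d → R) :
    LinRepro N w C ↔ ∀ κ,
      (M1 κ w = ((N : ℂ) ^ d) • C κ ∧
        ∀ l : Fin d → ZMod N, l ≠ 0 → aliasMoment N (fun u => u κ) l w = 0) := by
  have h : LinRepro N w C ↔ ∀ κ a, cosetMoment N (fun u => u κ) w a = C κ := by
    unfold LinRepro cosetMoment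
    exact forall_comm
  rw [h]
  exact forall_congr' (fun κ => cosetMoment_const_iff N (fun u => u κ) w (C κ))

/-- **(L0) ∧ (L1) ⟺ THE SYMBOL AND ITS GRADIENT VANISH AT EVERY NON-ZERO ALIAS** (with the two normalisations):
the exact finite form of the Strang–Fix conditions for affine reproduction (degree `m = 1`) with respect to the
coarse lattice `N•ℤ^d`. [folklore] -/
theorem affineRepro_iff_alias (w : LatFun d R) (σ : R) (C : Fin d → R) :
    (ConstRepro N w σ ∧ LinRepro N w C) ↔
      ((M0 w = ((N : ℂ) ^ d) • σ ∧ ∀ κ, M1 κ w = ((N : ℂ) ^ d) • C κ) ∧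
        ∀ l : Fin d → ZMod N, l ≠ 0 →
          (aliasMoment N (fun _ => 1) l w = 0 ∧ ∀ κ, aliasMoment N (fun u => u κ) l w = 0)) := by
  rw [constRepro_iff_alias, linRepro_iff_alias]
  constructor
  · rintro ⟨⟨h0, hA0⟩, h1⟩
    exact ⟨⟨h0, fun κ => (h1 κ).1⟩, fun l hl => ⟨hA0 l hl, fun κ => (h1 κ).2 l hl⟩⟩
  · rintro ⟨⟨h0, h1⟩, hal⟩
    exact ⟨⟨h0, fun l hl => (hal l hl).1⟩, fun κ => ⟨h1 κ, fun l hl => (hal l hl).2 κ⟩⟩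

/-- Normalisation-free (L0): `w` reproduces constants for SOME `σ` ⟺ pure alias vanishing of the symbol; then
`σ = N^{-d} • M0 w`. [folklore] -/
theorem exists_constRepro_iff_alias (w : LatFun d R) :
    (∃ σ, ConstRepro N w σ) ↔ ∀ l : Fin d → ZMod N, l ≠ 0 → aliasMoment N (fun _ => 1) l w = 0 := by
  constructor
  · rintro ⟨σ, h⟩
    exact ((constRepro_iff_alias N w σ).mp h).2
  · intro h
    refine ⟨((N : ℂ) ^ d)⁻¹ • M0 w, (constRepro_iff_alias N w _).mpr ⟨?_, h⟩⟩
    rw [smul_inv_smul₀ (pow_ne_zero _ (Nat.cast_ne_zero.mpr (NeZero.ne N)))]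

/-- Normalisation-free (L1): `w` has coset-independent first moments for SOME `C` ⟺ all first alias moments vanish at
the non-zero aliases; then `C κ = N^{-d} • M1 κ w`. [folklore] -/
theorem exists_linRepro_iff_alias (w : LatFun d R) :
    (∃ C, LinRepro N w C) ↔
      ∀ l : Fin d → ZMod N, l ≠ 0 → ∀ κ, aliasMoment N (fun u => u κ) l w = 0 := by
  constructor
  · rintro ⟨C, h⟩ l hl κ
    exact ((linRepro_iff_alias N w C).mp h κ).2 l hl
  · intro h
    refine ⟨fun κ => ((N : ℂ) ^ d)⁻¹ • M1 κ w, (linRepro_iff_alias N w _).mpr (fun κ => ⟨?_, fun l hl => h l hl κ⟩)⟩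
    rw [smul_inv_smul₀ (pow_ne_zero _ (Nat.cast_ne_zero.mpr (NeZero.ne N)))]

end Lattice

end Literature.MathematicalPhysics.QuantumFieldTheory.Balaban1983to89.Beta.StrangFixAlias
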